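import Literature.Analysis.FluidPDE.SelfSimilarEulerVorticityExclusionHolds
import Literature.Analysis.FluidPDE.SelfSimilarEulerEnergyLowerBound
import Literature.Analysis.FluidPDE.SelfSimilarEulerPressureRecovery
import Literature.Analysis.FluidPDE.VorticityCalculus
import Mathlib.Analysis.SpecialFunctions.JapaneseBracket
import HarnessLib

/-!
# Chae–Shvydkoy 2013, Theorem 4.2: self-similar Euler profiles which are homogeneous near
# infinity of a NON-natural degree are trivial; no compactly supported profiles

Analysis/FluidPDE proof file (theorems only; no definitions, no named facts, no `sorry`) for

* D. Chae, R. Shvydkoy, *On formation of a locally self-similar collapse in the incompressible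
  Euler equations*, ARMA 209 (2013) = arXiv:1201.6009 [ChaeShvydkoy2013], §4.1 (held text
  p. 10): "We say that a field `v ∈ C¹_loc(ℝᴺ)` is homogeneous near infinity if
  `v(y) = V(y|y|⁻¹)/|y|^β` holds for all `y` large enough … **Theorem 4.2.** Suppose `v` is a
  homogeneous near infinity solution and any of these conditions are satisfied (i) `0 < β < α`,
  (ii) `−1 < α < β`, (iii) `α = β = N/2`. Then `v = 0`, except in the case `β = 0` which implies
  that `v` is constant."  Proof of (i): "by Corollary 3.4, (3.12) holds. On the other hand,
  `∫_{L≤|y|≤2L}|v|² ∼ L^{N−2β}∫|V|²`, which necessitates `β ≥ α`, unless `V = 0`. If `V = 0`,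
  however, then Theorem 4.1 … applies to find … `v = 0`."

in the vocabulary of `SelfSimilarEulerHomogeneousTail.lean` (a globally homogeneous `W`,
`W(c x) = c^{−β} W(x)` for `c > 0`, `x ≠ 0`, with `U = W` on `{‖y‖ > R}`), dimension `N = 3`,
profiles `IsSelfSimilarEulerProfile (1/(α+1)) 0 U P` (`U ∈ C²`, `P ∈ C¹`).

* `IsSelfSimilarEulerProfile.eq_zero_of_eq_zero_of_le_norm` — **no compactly supported
  profiles** (any `α > −1`): the last step of the printed proof, via the tree's PROVED
  Theorem 4.1 `chaeShvydkoy2013_vorticity_exclusion_holds` (vorticity continuous with compact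
  support ⇒ in `L^p`, `p = 3/(2(1+α))`; strain zero near infinity);
* `setIntegral_shell_normSq_of_homogeneous_tail` — `∫_{sR<|y|<2sR}|U|² = s^{3−2β}∫_{R<|y|<2R}|U|²`;
* `IsSelfSimilarEulerProfile.eq_zero_of_homogeneous_tail_of_lt` — **Thm 4.2 (i) in energy-growth
  form**: profile + `∫_{|y|<L}|U|² ≤ C L^{3−2α}` for large `L` + homogeneous tail of degree `−β`,
  `β < α` ⇒ `U ≡ 0` (here `β ≤ 0`, growing tails, is allowed: the growth bound is the hypothesis);
* `eq_zero_of_locallySelfSimilar_of_homogeneous_tail_of_lt` — **ambient form, NO integrability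
  hypotheses**: an exact locally self-similar collapse of a classical finite-energy Euler solution
  in the Beale–Kato–Majda class (energy growth by `energyGrowth_of_locallySelfSimilar`, profile
  system by `exists_pressureProfile_of_locallySelfSimilar`) cannot have a profile homogeneous
  near infinity of degree `−β` with `β < α`;
* `IsSelfSimilarEulerProfile.eq_zero_of_memLp_of_homogeneous_tail_of_lt` — **Thm 4.2 (i) as
  printed** (`U ∈ L^p`, `P ∈ L^{p/2}`, window `3/p < α ≤ 3/2`, growth from Cor. 3.4
  `energyGrowth_of_memLp_of_window'`).

* `fderiv_smul_of_homogeneous_tail`, `exists_norm_fderiv_le_of_homogeneous_tail` — the gradient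
  of a homogeneous tail: `DU(cx) = c^{−(β+1)} DU(x)`, `‖DU(y)‖ ≤ M (‖y‖/2R)^{−(β+1)}`;
* `IsSelfSimilarEulerProfile.exists_eq_const_of_homogeneous_tail_of_gt`,
  `IsSelfSimilarEulerProfile.eq_zero_of_homogeneous_tail_of_gt` — **Thm 4.2 (ii)**: `−1 < α < β`
  ⇒ `U` constant (≡ 0 if `β ≠ 0`), via Theorem 4.1 with `ω ∈ L^p`, `3/(1+β) < p < 3/(1+α)`
  (strain `→ 0` and `curl U` dominated by `A(1+‖y‖)^{−(β+1)} ∈ L^p`, `integrable_one_add_norm`);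
  NO integrability hypothesis on `(U, P)`;
* `IsSelfSimilarEulerProfile.eq_zero_of_shellEnergy_eq_zero_of_homogeneous_tail` (zero shell
  energy ⇒ trivial) and `IsSelfSimilarEulerProfile.eq_zero_of_homogeneous_tail_three_halves` —
  **Thm 4.2 (iii)**: `α = β = 3/2` with bounded ball energies ⇒ `U ≡ 0` (all dyadic shells carry
  the same energy).

* `eq_zero_of_locallySelfSimilar_of_homogeneous_tail_of_gt`,
  `eq_zero_of_locallySelfSimilar_of_homogeneous_tail_three_halves`,
  `eq_zero_of_locallySelfSimilar_of_eq_zero_of_le_norm` — the AMBIENT forms of (ii), (iii) and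
  of the compact-support exclusion for an exact locally self-similar collapse of a classical
  Euler solution (BKM class for (iii)), with no integrability hypotheses.

The scaling-invariant case `β = α` is the bridge file `SelfSimilarEulerHomogeneousTail.lean`
(open in print except `α = 1`, Shvydkoy 2018 Prop. 2.1). Census reading (ns-blowup zones Z5–Z8):
with `c_l = 1/(1+α)`, an exact collapse profile whose far field is a clean power law
`|U| ≈ |y|^{−β}` must have EXACTLY `β = 1/c_l − 1`: flatter tails (and growing ones) are excluded
given the energy growth (automatic for ambient finite-energy collapses), steeper tails are excluded
outright, both without any integrability assumption on `(U, P)`; and no profile is compactly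
supported.

## Mathlib / tree search

`lean search 'homogeneous_tail|HomogeneousNearInfinity|eq_zero_of_eq_zero_of_le_norm|hasCompactSupport.*Profile'`:
the tree has the `β = α` bridge (`IsSelfSimilarEulerProfile.isHomogeneousSteadyEuler_of_homogeneous_tail`,
`…tail_eq_zero_of_homogeneous_tail_half`) and Theorem 4.1 proved, but no Thm 4.2 case and no
compact-support exclusion (2026-08-27). Reused: `chaeShvydkoy2013_vorticity_exclusion_holds`,
`continuous_curl`, `hasCompactSupport_curl` (`VorticityCalculus.lean`), `energyGrowth_of_locallySelfSimilar`,
`exists_pressureProfile_of_locallySelfSimilar`, `IsSelfSimilarEulerProfile.energyGrowth_of_memLp_of_window'`;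
Mathlib `Continuous.memLp_of_hasCompactSupport`, `HasCompactSupport.compl_mem_cocompact`,
`fderiv_of_notMem_tsupport`, `Measure.setIntegral_comp_smul_of_pos`, `Set.mem_smul_set_iff_inv_smul_mem₀`,
`setIntegral_pos_iff_support_of_nonneg_ae`, `tendsto_rpow_neg_atTop`, `integrable_one_add_norm`,
`integrable_norm_rpow_iff`, `MemLp.of_le`, `LinearIsometryEquiv.norm_map`, `tendsto_norm_cocompact_atTop`,
`norm_curl_le` (`TaoEnstrophyLocalisation.lean`). No new definitions, no instances, no notation.

## References

* D. Chae, R. Shvydkoy, ARMA 209 (2013) 999–1017 = arXiv:1201.6009, §4.1 Thm. 4.2, §4 Thm. 4.1,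
  §3.2.3 Cor. 3.4. [ChaeShvydkoy2013]
* A. Bronzi, R. Shvydkoy, Indiana Univ. Math. J. 64 (2015) = arXiv:1310.8611, §1 eq. (1.6),
  Lemma 2.1. [BronziShvydkoy2015]
-/

noncomputable section

open MeasureTheory Set Filter Topology Metric
open scoped ENNReal NNReal Pointwise

namespace Literature.Analysis.FluidPDE

section CompactSupport

/-- **No compactly supported self-similar Euler profiles** (the last step of the proof of
Chae–Shvydkoy 2013 Thm 4.2: "If `V = 0`, however, then Theorem 4.1 … applies to find … `v = 0`"):
a `C²` stationary self-similar Euler profile with exponent `γ = 1/(α+1)`, `α > −1`, whose velocity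
vanishes outside a ball is identically zero. Kernel proof: the vorticity `curl U` is continuous
with compact support, hence in every `L^p`, and the strain vanishes near infinity, so
Chae–Shvydkoy's vorticity exclusion (Thm 4.1, the tree's PROVED
`chaeShvydkoy2013_vorticity_exclusion_holds`, with `p = 3/(2(1+α)) ∈ (0, 3/(1+α))`) makes `U`
constant, and the constant is `U(y) = 0` far out. No integrability of the pressure is needed.
[cite: ChaeShvydkoy2013, §4.1 Thm. 4.2 (proof, case (i)) with §4 Thm. 4.1] -/
theorem IsSelfSimilarEulerProfile.eq_zero_of_eq_zero_of_le_norm {α R : ℝ}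
    {U : EuclideanSpace ℝ (Fin 3) → EuclideanSpace ℝ (Fin 3)} {P : EuclideanSpace ℝ (Fin 3) → ℝ}
    (h : IsSelfSimilarEulerProfile (1 / (α + 1)) 0 U P) (hα : -1 < α)
    (hzero : ∀ y : EuclideanSpace ℝ (Fin 3), R ≤ ‖y‖ → U y = 0) : U = 0 := by
  have hα1 : 0 < α + 1 := by linarith
  -- compact support of `U`
  have hsupp : HasCompactSupport U := by
    refine HasCompactSupport.intro (isCompact_closedBall (0 : EuclideanSpace ℝ (Fin 3)) R) ?_
    intro y hy
    rw [mem_closedBall, dist_zero_right, not_le] at hy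
    exact hzero y hy.le
  -- the vorticity is continuous with compact support, hence in `L^p`
  set p : ℝ := 3 / (2 * (α + 1)) with hp_def
  have hp : 0 < p := by rw [hp_def]; positivity
  have hp3 : p < 3 / (1 + α) := by
    rw [hp_def, div_lt_div_iff_of_pos_left (by norm_num) (by positivity) (by linarith)]
    linarith
  have hΩp : MemLp (curl U) (ENNReal.ofReal p) volume :=
    (continuous_curl (h.contDiff_velocity.of_le (by norm_num))).memLp_of_hasCompactSupport
      (hasCompactSupport_curl hsupp)
  -- the strain vanishes outside the support
  have hstrain : Tendsto (fun y => ‖(1 / 2 : ℝ) • (fderiv ℝ U y +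
      ContinuousLinearMap.adjoint (fderiv ℝ U y))‖) (cocompact (EuclideanSpace ℝ (Fin 3))) (𝓝 0) := by
    refine tendsto_const_nhds.congr' ?_
    have hmem : (tsupport U)ᶜ ∈ cocompact (EuclideanSpace ℝ (Fin 3)) := hsupp.compl_mem_cocompact
    filter_upwards [hmem] with y hy
    have h0 : fderiv ℝ U y = 0 := fderiv_of_notMem_tsupport ℝ hy
    have h1 : (1 / 2 : ℝ) • (fderiv ℝ U y + ContinuousLinearMap.adjoint (fderiv ℝ U y)) = 0 := by
      rw [h0, map_zero, add_zero]
      exact smul_zero (A := EuclideanSpace ℝ (Fin 3) →L[ℝ] EuclideanSpace ℝ (Fin 3)) (1 / 2 : ℝ)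
    rw [h1, norm_zero]
  obtain ⟨b, hb⟩ := chaeShvydkoy2013_vorticity_exclusion_holds α p U P hα hp hp3 h hstrain hΩp
  -- the constant is zero: evaluate far out
  obtain ⟨y₀, hy₀⟩ : ∃ y : EuclideanSpace ℝ (Fin 3), R ≤ ‖y‖ := by
    obtain ⟨e, he⟩ := exists_ne (0 : EuclideanSpace ℝ (Fin 3))
    have hen : 0 < ‖e‖ := norm_pos_iff.mpr he
    refine ⟨((|R| + 1) / ‖e‖) • e, ?_⟩
    rw [norm_smul, Real.norm_of_nonneg (by positivity), div_mul_cancel₀ _ hen.ne']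
    linarith [le_abs_self R]
  have hb0 : b = 0 := by rw [← hb y₀, hzero y₀ hy₀]
  funext y
  rw [hb y, hb0, Pi.zero_apply]

end CompactSupport

section HomogeneousTail

/-- The Lebesgue-measurability of the dyadic shell `{R < ‖y‖ < 2R}` (an open set). [folklore] -/
private theorem measurableSet_twoShell (R : ℝ) :
    MeasurableSet {y : EuclideanSpace ℝ (Fin 3) | R < ‖y‖ ∧ ‖y‖ < 2 * R} :=
  ((isOpen_lt continuous_const continuous_norm).inter
    (isOpen_lt continuous_norm continuous_const)).measurableSet

/-- Dilating a dyadic shell: `c • {R < ‖y‖ < 2R} = {cR < ‖y‖ < 2cR}` for `c > 0`. [folklore] -/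
private theorem smul_twoShell {R c : ℝ} (hc : 0 < c) :
    c • {y : EuclideanSpace ℝ (Fin 3) | R < ‖y‖ ∧ ‖y‖ < 2 * R} =
      {y : EuclideanSpace ℝ (Fin 3) | c * R < ‖y‖ ∧ ‖y‖ < 2 * (c * R)} := by
  ext y
  rw [Set.mem_smul_set_iff_inv_smul_mem₀ hc.ne', mem_setOf_eq, mem_setOf_eq, norm_smul, norm_inv,
    Real.norm_of_nonneg hc.le, inv_mul_eq_div, lt_div_iff₀ hc, div_lt_iff₀ hc]
  constructor
  · rintro ⟨h1, h2⟩; exact ⟨by linarith [mul_comm R c], by linarith [mul_comm R c]⟩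
  · rintro ⟨h1, h2⟩; exact ⟨by linarith [mul_comm R c], by linarith [mul_comm R c]⟩

/-- **Shell energies of a homogeneous tail scale exactly.** If `U = W` on `{R < ‖y‖}` (`R > 0`)
with `W` homogeneous of degree `−β` off the origin (`W(c x) = c^{−β} W(x)`, `c > 0`), then for
`s ≥ 1`, `∫_{sR<|y|<2sR} |U|² = s^{3−2β} ∫_{R<|y|<2R} |U|²` (substitution `y = s z`; the
computation "`∫_{L≤|y|≤2L}|v|² ∼ L^{N−2β} ∫_{S^{N−1}}|V|²`" of Chae–Shvydkoy).
[cite: ChaeShvydkoy2013, §4.1 Thm. 4.2 (proof of case (i))] -/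
theorem setIntegral_shell_normSq_of_homogeneous_tail {β R : ℝ}
    {U W : EuclideanSpace ℝ (Fin 3) → EuclideanSpace ℝ (Fin 3)} (hR : 0 < R)
    (hW : ∀ ⦃c : ℝ⦄, 0 < c → ∀ ⦃x : EuclideanSpace ℝ (Fin 3)⦄, x ≠ 0 → W (c • x) = c ^ (-β) • W x)
    (hUW : ∀ ⦃y : EuclideanSpace ℝ (Fin 3)⦄, R < ‖y‖ → U y = W y) {s : ℝ} (hs : 1 ≤ s) :
    ∫ y in {y : EuclideanSpace ℝ (Fin 3) | s * R < ‖y‖ ∧ ‖y‖ < 2 * (s * R)}, ‖U y‖ ^ 2 =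
      s ^ (3 - 2 * β) *
        ∫ y in {y : EuclideanSpace ℝ (Fin 3) | R < ‖y‖ ∧ ‖y‖ < 2 * R}, ‖U y‖ ^ 2 := by
  have hs0 : 0 < s := by linarith
  set S : Set (EuclideanSpace ℝ (Fin 3)) := {y | R < ‖y‖ ∧ ‖y‖ < 2 * R} with hS_def
  have hsub := Measure.setIntegral_comp_smul_of_pos (volume : Measure (EuclideanSpace ℝ (Fin 3)))
    (fun y : EuclideanSpace ℝ (Fin 3) => ‖W y‖ ^ 2) S hs0
  rw [hS_def, smul_twoShell hs0, finrank_euclideanSpace_fin, smul_eq_mul] at hsub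
  -- the left side of `hsub` by homogeneity
  have hlhs : ∫ x in S, ‖W (s • x)‖ ^ 2 = s ^ (-(2 * β)) * ∫ x in S, ‖W x‖ ^ 2 := by
    rw [← integral_const_mul]
    refine setIntegral_congr_fun (measurableSet_twoShell R) fun x hx => ?_
    have hx0 : x ≠ 0 := by
      intro h0
      rw [h0, mem_setOf_eq, norm_zero] at hx
      linarith [hx.1]
    rw [hW hs0 hx0, norm_smul, mul_pow, Real.norm_of_nonneg (Real.rpow_nonneg hs0.le _),
      ← Real.rpow_natCast (s ^ (-β)), ← Real.rpow_mul hs0.le]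
    congr 1
    push_cast
    ring_nf
  -- both shells lie in `{R < ‖y‖}`, where `U = W`
  have hout : ∫ y in {y : EuclideanSpace ℝ (Fin 3) | s * R < ‖y‖ ∧ ‖y‖ < 2 * (s * R)}, ‖U y‖ ^ 2 =
      ∫ y in {y : EuclideanSpace ℝ (Fin 3) | s * R < ‖y‖ ∧ ‖y‖ < 2 * (s * R)}, ‖W y‖ ^ 2 := by
    refine setIntegral_congr_fun (measurableSet_twoShell (s * R)) fun y hy => ?_
    have hRy : R < ‖y‖ := lt_of_le_of_lt (by nlinarith) hy.1
    rw [hUW hRy]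
  have hin : ∫ y in S, ‖U y‖ ^ 2 = ∫ y in S, ‖W y‖ ^ 2 := by
    refine setIntegral_congr_fun (measurableSet_twoShell R) fun y hy => ?_
    rw [hUW hy.1]
  rw [hout, hin]
  rw [hS_def] at hlhs
  rw [hlhs] at hsub
  -- `hsub : s^{-2β} ∫_S ‖W‖² = (s^3)⁻¹ * ∫_{sS} ‖W‖²`
  have hs3 : (0 : ℝ) < s ^ 3 := pow_pos hs0 3
  have key : ∫ y in {y : EuclideanSpace ℝ (Fin 3) | s * R < ‖y‖ ∧ ‖y‖ < 2 * (s * R)}, ‖W y‖ ^ 2 =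
      s ^ 3 * (s ^ (-(2 * β)) *
        ∫ x in {y : EuclideanSpace ℝ (Fin 3) | R < ‖y‖ ∧ ‖y‖ < 2 * R}, ‖W x‖ ^ 2) := by
    rw [hsub, mul_inv_cancel_left₀ hs3.ne']
  rw [key]
  have e3 : (s ^ 3 : ℝ) * s ^ (-(2 * β)) = s ^ (3 - 2 * β) := by
    rw [show (s ^ 3 : ℝ) = s ^ ((3 : ℕ) : ℝ) by rw [Real.rpow_natCast], ← Real.rpow_add hs0]
    norm_num
    ring_nf
  rw [← e3]
  ring

/-- **Chae–Shvydkoy 2013, Theorem 4.2 (i), energy-growth form: a homogeneous tail FLATTER than the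
natural one is excluded.** Let `(U, P)` be a `C²` stationary self-similar Euler profile with
exponent `γ = 1/(α+1)`, `α > −1`, whose ball energies obey `∫_{|y|<L}|U|² ≤ C L^{3−2α}` for
`L ≥ L₀` (Chae–Shvydkoy (1.3) — automatic for an exact locally self-similar collapse of a
finite-energy solution, `energyGrowth_of_locallySelfSimilar`, and for `L^p` profiles in the
window by Cor. 3.4), and which is **homogeneous near infinity** of degree `−β`: `U = W` on
`{‖y‖ > R}` with `W(c x) = c^{−β} W(x)` (`c > 0`, `x ≠ 0`). If `β < α` then `U ≡ 0`: the shells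
`{sR < |y| < 2sR}` carry energy `s^{3−2β} I` (`setIntegral_shell_normSq_of_homogeneous_tail`),
incompatible with `≲ s^{3−2α}` unless `I = 0`; then `U` vanishes on the shell, hence (homogeneity)
outside `B_R`, hence everywhere (`eq_zero_of_eq_zero_of_le_norm`, Chae–Shvydkoy Thm 4.1). Printed
case (i) is `0 < β < α` for `L^p` data; here `β ≤ 0` (growing tails) is covered as well, the
energy growth being the hypothesis. [cite: ChaeShvydkoy2013, §4.1 Thm. 4.2 (i)] -/
theorem IsSelfSimilarEulerProfile.eq_zero_of_homogeneous_tail_of_lt {α β R C L₀ : ℝ}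
    {U W : EuclideanSpace ℝ (Fin 3) → EuclideanSpace ℝ (Fin 3)} {P : EuclideanSpace ℝ (Fin 3) → ℝ}
    (h : IsSelfSimilarEulerProfile (1 / (α + 1)) 0 U P) (hα : -1 < α) (hβ : β < α) (hR : 0 < R)
    (hW : ∀ ⦃c : ℝ⦄, 0 < c → ∀ ⦃x : EuclideanSpace ℝ (Fin 3)⦄, x ≠ 0 → W (c • x) = c ^ (-β) • W x)
    (hUW : ∀ ⦃y : EuclideanSpace ℝ (Fin 3)⦄, R < ‖y‖ → U y = W y)
    (hgrowth : ∀ L : ℝ, L₀ ≤ L →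
      ∫ y in ball (0 : EuclideanSpace ℝ (Fin 3)) L, ‖U y‖ ^ 2 ≤ C * L ^ (3 - 2 * α)) :
    U = 0 := by
  have hcont : Continuous fun y : EuclideanSpace ℝ (Fin 3) => ‖U y‖ ^ 2 :=
    (h.contDiff_velocity.continuous.norm).pow 2
  set S : Set (EuclideanSpace ℝ (Fin 3)) := {y | R < ‖y‖ ∧ ‖y‖ < 2 * R} with hS_def
  set I : ℝ := ∫ y in S, ‖U y‖ ^ 2 with hI_def
  have hI0 : 0 ≤ I := setIntegral_nonneg (measurableSet_twoShell R) fun y _ => by positivity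
  -- Step 1: the shell energy vanishes
  have hI : I = 0 := by
    by_contra hIne
    have hIpos : 0 < I := lt_of_le_of_ne hI0 (Ne.symm hIne)
    set K : ℝ := C * (2 * R) ^ (3 - 2 * α) with hK_def
    have hbound : ∀ s : ℝ, 1 ≤ s → L₀ ≤ 2 * (s * R) → I ≤ K * s ^ (-(2 * (α - β))) := by
      intro s hs hsL
      have hs0 : 0 < s := by linarith
      have hshell := setIntegral_shell_normSq_of_homogeneous_tail hR hW hUW hs
      -- shell ⊆ ball (0, 2 s R)
      have hsubset : {y : EuclideanSpace ℝ (Fin 3) | s * R < ‖y‖ ∧ ‖y‖ < 2 * (s * R)} ⊆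
          ball (0 : EuclideanSpace ℝ (Fin 3)) (2 * (s * R)) := fun y hy => by
        rw [mem_ball_zero_iff]; exact hy.2
      have hint : IntegrableOn (fun y : EuclideanSpace ℝ (Fin 3) => ‖U y‖ ^ 2)
          (ball (0 : EuclideanSpace ℝ (Fin 3)) (2 * (s * R))) volume :=
        (hcont.continuousOn.integrableOn_compact (isCompact_closedBall 0 _)).mono_set
          ball_subset_closedBall
      have h1 : s ^ (3 - 2 * β) * I ≤ C * (2 * (s * R)) ^ (3 - 2 * α) := by
        rw [hI_def, ← hshell]
        exact (setIntegral_mono_set hint (ae_of_all _ fun y => by positivity)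
          (ae_of_all _ hsubset)).trans (hgrowth _ hsL)
      have h2 : C * (2 * (s * R)) ^ (3 - 2 * α) = K * s ^ (3 - 2 * α) := by
        rw [hK_def, show 2 * (s * R) = (2 * R) * s by ring,
          Real.mul_rpow (by positivity) hs0.le, mul_assoc]
      rw [h2] at h1
      have hs3 : 0 < s ^ (3 - 2 * β) := Real.rpow_pos_of_pos hs0 _
      rw [mul_comm] at h1
      rw [← le_div_iff₀ hs3] at h1
      refine h1.trans_eq ?_
      rw [mul_div_assoc, ← Real.rpow_sub hs0]
      congr 2
      ring
    have htend : Tendsto (fun s : ℝ => K * s ^ (-(2 * (α - β)))) atTop (𝓝 (K * 0)) :=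
      (tendsto_rpow_neg_atTop (by linarith)).const_mul K
    rw [mul_zero] at htend
    have hev : ∀ᶠ s : ℝ in atTop, L₀ ≤ 2 * (s * R) := by
      have : Tendsto (fun s : ℝ => 2 * (s * R)) atTop atTop := by
        have e : (fun s : ℝ => 2 * (s * R)) = fun s => (2 * R) * s := by funext s; ring
        rw [e]
        exact Tendsto.const_mul_atTop (by positivity) tendsto_id
      exact this.eventually (eventually_ge_atTop L₀)
    obtain ⟨s, hlt, hs1, hsL⟩ :=
      ((htend.eventually (gt_mem_nhds hIpos)).and ((eventually_ge_atTop 1).and hev)).exists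
    exact lt_irrefl _ ((hbound s hs1 hsL).trans_lt hlt)
  -- Step 2: `U = 0` on the shell
  have hshell0 : ∀ y ∈ S, U y = 0 := by
    by_contra hne
    push Not at hne
    obtain ⟨z, hzS, hz⟩ := hne
    have hint : IntegrableOn (fun y : EuclideanSpace ℝ (Fin 3) => ‖U y‖ ^ 2) S volume :=
      ((hcont.continuousOn.integrableOn_compact (isCompact_closedBall 0 (2 * R))).mono_set
        ball_subset_closedBall).mono_set fun y hy => by rw [mem_ball_zero_iff]; exact hy.2
    have hpos : 0 < I := by
      rw [hI_def, setIntegral_pos_iff_support_of_nonneg_ae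
        (Eventually.of_forall fun y => by simp only [Pi.zero_apply]; positivity) hint]
      have hopen : IsOpen ({y : EuclideanSpace ℝ (Fin 3) | ‖U y‖ ^ 2 ≠ 0} ∩ S) :=
        (isOpen_ne_fun hcont continuous_const).inter
          ((isOpen_lt continuous_const continuous_norm).inter
            (isOpen_lt continuous_norm continuous_const))
      exact hopen.measure_pos volume ⟨z, by simpa using hz, hzS⟩
    exact hpos.ne' hI
  -- Step 3: the tail `W` vanishes off the origin
  have hW0 : ∀ x : EuclideanSpace ℝ (Fin 3), x ≠ 0 → W x = 0 := by
    intro x hx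
    have hxn : 0 < ‖x‖ := norm_pos_iff.mpr hx
    set c : ℝ := (3 * R / 2) / ‖x‖ with hc_def
    have hc : 0 < c := by positivity
    have hcx : ‖c • x‖ = 3 * R / 2 := by
      rw [norm_smul, Real.norm_of_nonneg hc.le, hc_def, div_mul_cancel₀ _ hxn.ne']
    have hmem : c • x ∈ S := by
      rw [hS_def, mem_setOf_eq, hcx]; constructor <;> linarith
    have h1 : U (c • x) = 0 := hshell0 _ hmem
    rw [hUW (by rw [hcx]; linarith), hW hc hx] at h1
    exact (smul_eq_zero.mp h1).resolve_left (Real.rpow_pos_of_pos hc _).ne'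
  -- Step 4: `U` vanishes outside `B_R`, hence everywhere
  refine h.eq_zero_of_eq_zero_of_le_norm hα (R := R + 1) fun y hy => ?_
  have hy0 : y ≠ 0 := by
    intro h0; rw [h0, norm_zero] at hy; linarith
  rw [hUW (by linarith)]
  exact hW0 y hy0

/-- **Ambient form (no integrability hypotheses at all): an exact locally self-similar collapse
cannot have a homogeneous far field flatter than the natural one.** For a classical finite-energy
Euler solution on `[0,T)` in the Beale–Kato–Majda class, exactly locally self-similar on
`B_{ρ₀}(x₀)` with exponent `γ = 1/(α+1)`, `α > −1`, and a `C²` profile `v` homogeneous near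
infinity of degree `−β` with `β < α`, the profile is trivial: the energy growth (1.6) is supplied
by `energyGrowth_of_locallySelfSimilar` and the profile system by
`exists_pressureProfile_of_locallySelfSimilar`. Census reading: with `c_l = 1/(1+α)`, a power-law
far field `|v| ≈ |y|^{−β}` with `β < 1/c_l − 1` (slower than natural decay, or growth) is not
the far field of an exact collapse profile.
[cite: ChaeShvydkoy2013, §4.1 Thm. 4.2 (i); BronziShvydkoy2015, §1 eq. (1.6) and Lemma 2.1] -/
theorem eq_zero_of_locallySelfSimilar_of_homogeneous_tail_of_lt {T α ρ₀ β R : ℝ}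
    {x₀ : EuclideanSpace ℝ (Fin 3)}
    {u : ℝ → EuclideanSpace ℝ (Fin 3) → EuclideanSpace ℝ (Fin 3)}
    {p : ℝ → EuclideanSpace ℝ (Fin 3) → ℝ}
    {v W : EuclideanSpace ℝ (Fin 3) → EuclideanSpace ℝ (Fin 3)}
    (hT : 0 < T) (hα : -1 < α) (hρ₀ : 0 < ρ₀)
    (hsol : IsClassicalEulerSolutionOn (Ico 0 T) 0 u p)
    (hreg : ∀ T'' < T, HasBoundedSobolevNormsOn (Icc 0 T'') u)
    (hv : ContDiff ℝ 2 v)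
    (hss : ∀ t ∈ Ico 0 T, ∀ x ∈ ball x₀ ρ₀,
      u t x = selfSimilarCollapse (1 / (α + 1)) T v t (x - x₀))
    (hβ : β < α) (hR : 0 < R)
    (hW : ∀ ⦃c : ℝ⦄, 0 < c → ∀ ⦃x : EuclideanSpace ℝ (Fin 3)⦄, x ≠ 0 → W (c • x) = c ^ (-β) • W x)
    (hvW : ∀ ⦃y : EuclideanSpace ℝ (Fin 3)⦄, R < ‖y‖ → v y = W y) :
    v = 0 := by
  have hγ : 0 < 1 / (α + 1) := by
    have : 0 < α + 1 := by linarith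
    positivity
  obtain ⟨q, hprof, -⟩ := exists_pressureProfile_of_locallySelfSimilar hT hγ hρ₀ hsol hv hss
  exact hprof.eq_zero_of_homogeneous_tail_of_lt hα hβ hR hW hvW
    fun L hL => energyGrowth_of_locallySelfSimilar hT hα hρ₀ hsol hreg hss hL

/-- **Chae–Shvydkoy 2013, Theorem 4.2 (i) as printed (the `L^p` class).** A `C²` profile with
exponent `γ = 1/(α+1)`, `U ∈ L^p`, `P ∈ L^{p/2}` (`3 ≤ p < ∞`), in the window `3/p < α ≤ 3/2`,
homogeneous near infinity of degree `−β` with `β < α`, is trivial (the energy growth is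
Corollary 3.4, `energyGrowth_of_memLp_of_window'`; outside the window, `α ≤ 3/p` or `α > 3/2`,
the profile is trivial with no tail hypothesis by Theorem 3.2, `chaeShvydkoy2013_Lp_exclusion_holds`).
[cite: ChaeShvydkoy2013, §4.1 Thm. 4.2 (i) with §3.2.3 Cor. 3.4] -/
theorem IsSelfSimilarEulerProfile.eq_zero_of_memLp_of_homogeneous_tail_of_lt {α β R p : ℝ}
    {U W : EuclideanSpace ℝ (Fin 3) → EuclideanSpace ℝ (Fin 3)} {P : EuclideanSpace ℝ (Fin 3) → ℝ}
    (h : IsSelfSimilarEulerProfile (1 / (α + 1)) 0 U P) (hp : 3 ≤ p) (hαp : 3 / p < α)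
    (hα2 : α ≤ 3 / 2) (hU : MemLp U (ENNReal.ofReal p) volume)
    (hP : MemLp P (ENNReal.ofReal (p / 2)) volume) (hβ : β < α) (hR : 0 < R)
    (hW : ∀ ⦃c : ℝ⦄, 0 < c → ∀ ⦃x : EuclideanSpace ℝ (Fin 3)⦄, x ≠ 0 → W (c • x) = c ^ (-β) • W x)
    (hUW : ∀ ⦃y : EuclideanSpace ℝ (Fin 3)⦄, R < ‖y‖ → U y = W y) :
    U = 0 := by
  have hα : -1 < α := by
    have : 0 ≤ 3 / p := div_nonneg (by norm_num) (by linarith)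
    linarith
  obtain ⟨C, -, hC⟩ := h.energyGrowth_of_memLp_of_window' hp hαp hα2 hU hP
  exact h.eq_zero_of_homogeneous_tail_of_lt hα hβ hR hW hUW hC

end HomogeneousTail

section FasterTail

/-- **Scaling of the velocity gradient on a homogeneous tail.** If `U = W` on `{‖y‖ > R}` with
`W(c x) = c^{−β} W(x)` (`c > 0`, `x ≠ 0`) and `U` is differentiable, then for `‖x‖ > R`, `c ≥ 1`:
`DU(c x) = c^{−(β+1)} DU(x)` (differentiate `z ↦ U(cz) = c^{−β} U(z)` near `x`).
[cite: ChaeShvydkoy2013, §4.1 Thm. 4.2 (proof of case (ii): "`|∇v| ∼ |y|^{−β−1}`")] -/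
theorem fderiv_smul_of_homogeneous_tail {β R : ℝ}
    {U W : EuclideanSpace ℝ (Fin 3) → EuclideanSpace ℝ (Fin 3)} (hU : Differentiable ℝ U)
    (hR : 0 < R)
    (hW : ∀ ⦃c : ℝ⦄, 0 < c → ∀ ⦃x : EuclideanSpace ℝ (Fin 3)⦄, x ≠ 0 → W (c • x) = c ^ (-β) • W x)
    (hUW : ∀ ⦃y : EuclideanSpace ℝ (Fin 3)⦄, R < ‖y‖ → U y = W y)
    {x : EuclideanSpace ℝ (Fin 3)} (hx : R < ‖x‖) {c : ℝ} (hc : 1 ≤ c) :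
    fderiv ℝ U (c • x) = c ^ (-(β + 1)) • fderiv ℝ U x := by
  have hc0 : 0 < c := by linarith
  -- `U (c • z) = c^{-β} • U z` near `x`
  have hev : (fun z : EuclideanSpace ℝ (Fin 3) => U (c • z)) =ᶠ[𝓝 x]
      fun z => c ^ (-β) • U z := by
    have hopen : IsOpen {z : EuclideanSpace ℝ (Fin 3) | R < ‖z‖} :=
      isOpen_lt continuous_const continuous_norm
    filter_upwards [hopen.mem_nhds hx] with z hz
    have hz' : R < ‖z‖ := hz
    have hz0 : z ≠ 0 := by
      intro h0; rw [h0, norm_zero] at hz'; linarith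
    have hcz : R < ‖c • z‖ := by
      rw [norm_smul, Real.norm_of_nonneg hc0.le]
      nlinarith
    rw [hUW hcz, hW hc0 hz0, hUW hz']
  -- differentiate both sides at `x`
  have hlin : HasFDerivAt (fun z : EuclideanSpace ℝ (Fin 3) => c • z)
      (c • ContinuousLinearMap.id ℝ (EuclideanSpace ℝ (Fin 3))) x :=
    (hasFDerivAt_id x).const_smul c
  have hcomp : HasFDerivAt (fun z : EuclideanSpace ℝ (Fin 3) => U (c • z))
      ((fderiv ℝ U (c • x)).comp (c • ContinuousLinearMap.id ℝ (EuclideanSpace ℝ (Fin 3)))) x :=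
    (hU (c • x)).hasFDerivAt.comp x hlin
  have hrhs : HasFDerivAt (fun z : EuclideanSpace ℝ (Fin 3) => c ^ (-β) • U z)
      (c ^ (-β) • fderiv ℝ U x) x := (hU x).hasFDerivAt.fun_const_smul _
  have heq := (hcomp.congr_of_eventuallyEq hev.symm).unique hrhs
  -- heq : DU(cx) ∘ (c • id) = c^{-β} • DU x
  refine ContinuousLinearMap.ext fun v => ?_
  have h1 := congrArg (fun L : EuclideanSpace ℝ (Fin 3) →L[ℝ] EuclideanSpace ℝ (Fin 3) =>
    L (c⁻¹ • v)) heq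
  simp only [ContinuousLinearMap.comp_apply, FunLike.coe_smul, Pi.smul_apply,
    ContinuousLinearMap.id_apply, smul_smul, map_smul] at h1
  rw [inv_mul_cancel₀ hc0.ne', one_smul] at h1
  change fderiv ℝ U (c • x) v = c ^ (-(β + 1)) • fderiv ℝ U x v
  rw [h1]
  congr 1
  rw [Real.rpow_neg hc0.le (β + 1), Real.rpow_add hc0, Real.rpow_one, mul_inv,
    Real.rpow_neg hc0.le, mul_comm]

/-- **Gradient decay on a homogeneous tail**: `‖DU(y)‖ ≤ M (‖y‖/(2R))^{−(β+1)}` for `‖y‖ ≥ 2R`,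
with `M = max_{‖x‖ = 2R} ‖DU(x)‖`. [cite: ChaeShvydkoy2013, §4.1 Thm. 4.2 (proof of case (ii))] -/
theorem exists_norm_fderiv_le_of_homogeneous_tail {β R : ℝ}
    {U W : EuclideanSpace ℝ (Fin 3) → EuclideanSpace ℝ (Fin 3)} (hU : ContDiff ℝ 1 U)
    (hR : 0 < R)
    (hW : ∀ ⦃c : ℝ⦄, 0 < c → ∀ ⦃x : EuclideanSpace ℝ (Fin 3)⦄, x ≠ 0 → W (c • x) = c ^ (-β) • W x)
    (hUW : ∀ ⦃y : EuclideanSpace ℝ (Fin 3)⦄, R < ‖y‖ → U y = W y) :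
    ∃ M : ℝ, 0 ≤ M ∧ ∀ y : EuclideanSpace ℝ (Fin 3), 2 * R ≤ ‖y‖ →
      ‖fderiv ℝ U y‖ ≤ M * (‖y‖ / (2 * R)) ^ (-(β + 1)) := by
  have hdiff : Differentiable ℝ U := hU.differentiable one_ne_zero
  have hDcont : Continuous (fderiv ℝ U) := hU.continuous_fderiv one_ne_zero
  obtain ⟨M, hM⟩ := (isCompact_sphere (0 : EuclideanSpace ℝ (Fin 3)) (2 * R)).exists_bound_of_continuousOn
    hDcont.continuousOn
  refine ⟨max M 0, le_max_right _ _, fun y hy => ?_⟩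
  have hyn : 0 < ‖y‖ := by linarith
  set c : ℝ := ‖y‖ / (2 * R) with hc_def
  have hc : 1 ≤ c := by rw [hc_def, le_div_iff₀ (by positivity)]; linarith
  have hc0 : 0 < c := by linarith
  set x : EuclideanSpace ℝ (Fin 3) := c⁻¹ • y with hx_def
  have hxn : ‖x‖ = 2 * R := by
    rw [hx_def, norm_smul, norm_inv, Real.norm_of_nonneg hc0.le, hc_def, inv_div,
      div_mul_cancel₀ _ hyn.ne']
  have hxR : R < ‖x‖ := by rw [hxn]; linarith
  have hyx : y = c • x := by rw [hx_def, smul_smul, mul_inv_cancel₀ hc0.ne', one_smul]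
  have hx_mem : x ∈ sphere (0 : EuclideanSpace ℝ (Fin 3)) (2 * R) := by
    rw [mem_sphere_zero_iff_norm, hxn]
  rw [hyx, fderiv_smul_of_homogeneous_tail hdiff hR hW hUW hxR hc, norm_smul,
    Real.norm_of_nonneg (Real.rpow_nonneg hc0.le _), mul_comm]
  exact mul_le_mul_of_nonneg_right ((hM x hx_mem).trans (le_max_left _ _))
    (Real.rpow_nonneg hc0.le _)

/-- **Chae–Shvydkoy 2013, Theorem 4.2 (ii): a homogeneous tail STEEPER than the natural one forces
a constant profile.** Let `(U, P)` be a `C²` stationary self-similar Euler profile with exponent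
`γ = 1/(α+1)`, homogeneous near infinity of degree `−β` (`U = W` on `{‖y‖ > R}`,
`W(c x) = c^{−β} W(x)`), with `−1 < α < β`. Then `U` is constant ("In the case (ii) we have
`|∇v| ∼ |y|^{−β−1}`. Since `−1 < α < β`, there exists a `p > 0` with `N/(1+β) < p < N/(1+α)`. For
this `p`, `ω ∈ L^p`, and Theorem 4.1 applies"): kernel proof through the tree's PROVED
`chaeShvydkoy2013_vorticity_exclusion_holds` with `p = (3/(1+β) + 3/(1+α))/2`, the gradient decay
`‖DU(y)‖ ≤ M(‖y‖/2R)^{−(β+1)}` (`exists_norm_fderiv_le_of_homogeneous_tail`) giving both the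
vanishing of the strain at infinity and `curl U ∈ L^p` (domination by `A(1+‖y‖)^{−(β+1)}`,
`integrable_one_add_norm`). No integrability hypothesis on `(U, P)`.
[cite: ChaeShvydkoy2013, §4.1 Thm. 4.2 (ii) with §4 Thm. 4.1] -/
theorem IsSelfSimilarEulerProfile.exists_eq_const_of_homogeneous_tail_of_gt {α β R : ℝ}
    {U W : EuclideanSpace ℝ (Fin 3) → EuclideanSpace ℝ (Fin 3)} {P : EuclideanSpace ℝ (Fin 3) → ℝ}
    (h : IsSelfSimilarEulerProfile (1 / (α + 1)) 0 U P) (hα : -1 < α) (hβ : α < β) (hR : 0 < R)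
    (hW : ∀ ⦃c : ℝ⦄, 0 < c → ∀ ⦃x : EuclideanSpace ℝ (Fin 3)⦄, x ≠ 0 → W (c • x) = c ^ (-β) • W x)
    (hUW : ∀ ⦃y : EuclideanSpace ℝ (Fin 3)⦄, R < ‖y‖ → U y = W y) :
    ∃ b : EuclideanSpace ℝ (Fin 3), ∀ y, U y = b := by
  have hα1 : 0 < 1 + α := by linarith
  have hβ1 : 0 < β + 1 := by linarith
  have hβ1' : 0 < 1 + β := by linarith
  -- an exponent `p` with `3/(1+β) < p < 3/(1+α)`
  set p : ℝ := (3 / (1 + β) + 3 / (1 + α)) / 2 with hp_def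
  have hlt : 3 / (1 + β) < 3 / (1 + α) := div_lt_div_of_pos_left (by norm_num) hα1 (by linarith)
  have hpβ : 3 / (1 + β) < p := by rw [hp_def]; linarith
  have hpα : p < 3 / (1 + α) := by rw [hp_def]; linarith
  have hp0 : 0 < p := lt_trans (div_pos (by norm_num) hβ1') hpβ
  have hU1 : ContDiff ℝ 1 U := h.contDiff_velocity.of_le (by norm_num)
  obtain ⟨M, hM0, hM⟩ := exists_norm_fderiv_le_of_homogeneous_tail hU1 hR hW hUW
  -- the strain vanishes at infinity
  have hdecay : Tendsto (fun y : EuclideanSpace ℝ (Fin 3) => M * (‖y‖ / (2 * R)) ^ (-(β + 1)))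
      (cocompact (EuclideanSpace ℝ (Fin 3))) (𝓝 0) := by
    have h1 : Tendsto (fun r : ℝ => M * (r / (2 * R)) ^ (-(β + 1))) atTop (𝓝 (M * 0)) :=
      ((tendsto_rpow_neg_atTop hβ1).comp (tendsto_id.atTop_div_const (by positivity))).const_mul M
    rw [mul_zero] at h1
    exact h1.comp tendsto_norm_cocompact_atTop
  have hstrain : Tendsto (fun y => ‖(1 / 2 : ℝ) • (fderiv ℝ U y +
      ContinuousLinearMap.adjoint (fderiv ℝ U y))‖) (cocompact (EuclideanSpace ℝ (Fin 3))) (𝓝 0) := by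
    refine squeeze_zero_norm' ?_ hdecay
    have hev : ∀ᶠ y in cocompact (EuclideanSpace ℝ (Fin 3)), 2 * R ≤ ‖y‖ :=
      tendsto_norm_cocompact_atTop.eventually (eventually_ge_atTop _)
    filter_upwards [hev] with y hy
    rw [norm_norm]
    calc ‖(1 / 2 : ℝ) • (fderiv ℝ U y + ContinuousLinearMap.adjoint (fderiv ℝ U y))‖
        ≤ ‖(1 / 2 : ℝ)‖ * (‖fderiv ℝ U y‖ + ‖ContinuousLinearMap.adjoint (fderiv ℝ U y)‖) := by
          rw [norm_smul]
          exact mul_le_mul_of_nonneg_left (norm_add_le _ _) (norm_nonneg _)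
      _ = ‖fderiv ℝ U y‖ := by
          rw [LinearIsometryEquiv.norm_map, Real.norm_of_nonneg (by norm_num : (0 : ℝ) ≤ 1 / 2)]
          ring
      _ ≤ M * (‖y‖ / (2 * R)) ^ (-(β + 1)) := hM y hy
  -- the vorticity is in `L^p`
  have hcurl_cont : Continuous (curl U) := continuous_curl hU1
  obtain ⟨M₁, hM₁⟩ := (isCompact_closedBall (0 : EuclideanSpace ℝ (Fin 3)) (2 * R)).exists_bound_of_continuousOn
    hcurl_cont.continuousOn
  set κ : ℝ := ‖(curlCLM : (EuclideanSpace ℝ (Fin 3) →L[ℝ] EuclideanSpace ℝ (Fin 3)) →L[ℝ]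
    EuclideanSpace ℝ (Fin 3))‖ with hκ_def
  have hκ0 : 0 ≤ κ :=
    norm_nonneg (curlCLM : (EuclideanSpace ℝ (Fin 3) →L[ℝ] EuclideanSpace ℝ (Fin 3)) →L[ℝ]
      EuclideanSpace ℝ (Fin 3))
  set A : ℝ := max M₁ 0 * (1 + 2 * R) ^ (β + 1) + κ * M * (2 * R + 1) ^ (β + 1) with hA_def
  have hA0 : 0 ≤ A := by rw [hA_def]; positivity
  have hdom : ∀ y : EuclideanSpace ℝ (Fin 3), ‖curl U y‖ ≤ A * (1 + ‖y‖) ^ (-(β + 1)) := by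
    intro y
    have hJ : 0 < 1 + ‖y‖ := by positivity
    have hJr : 0 ≤ (1 + ‖y‖) ^ (-(β + 1)) := Real.rpow_nonneg hJ.le _
    by_cases hy : ‖y‖ ≤ 2 * R
    · have h1 : ‖curl U y‖ ≤ max M₁ 0 :=
        (hM₁ y (by rwa [mem_closedBall, dist_zero_right])).trans (le_max_left _ _)
      have h2 : (1 : ℝ) ≤ (1 + 2 * R) ^ (β + 1) * (1 + ‖y‖) ^ (-(β + 1)) := by
        rw [Real.rpow_neg hJ.le, ← div_eq_mul_inv, le_div_iff₀ (Real.rpow_pos_of_pos hJ _),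
          one_mul]
        exact Real.rpow_le_rpow hJ.le (by linarith) hβ1.le
      calc ‖curl U y‖ ≤ max M₁ 0 * 1 := by rw [mul_one]; exact h1
        _ ≤ max M₁ 0 * ((1 + 2 * R) ^ (β + 1) * (1 + ‖y‖) ^ (-(β + 1))) :=
            mul_le_mul_of_nonneg_left h2 (le_max_right _ _)
        _ = (max M₁ 0 * (1 + 2 * R) ^ (β + 1)) * (1 + ‖y‖) ^ (-(β + 1)) := by ring
        _ ≤ A * (1 + ‖y‖) ^ (-(β + 1)) := by
            refine mul_le_mul_of_nonneg_right ?_ hJr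
            rw [hA_def]
            exact le_add_of_nonneg_right (by positivity)
    · push Not at hy
      have hyn : 0 < ‖y‖ := by linarith
      have h1 : ‖curl U y‖ ≤ κ * (M * (‖y‖ / (2 * R)) ^ (-(β + 1))) :=
        (norm_curl_le U y).trans (mul_le_mul_of_nonneg_left (hM y hy.le) hκ0)
      have hq : 0 < ‖y‖ / (2 * R) := by positivity
      have h2 : (‖y‖ / (2 * R)) ^ (-(β + 1)) ≤ (2 * R + 1) ^ (β + 1) * (1 + ‖y‖) ^ (-(β + 1)) := by
        rw [Real.rpow_neg hq.le, Real.rpow_neg hJ.le, ← div_eq_mul_inv,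
          le_div_iff₀ (Real.rpow_pos_of_pos hJ _), ← Real.inv_rpow hq.le,
          ← Real.mul_rpow (inv_nonneg.2 hq.le) hJ.le]
        refine Real.rpow_le_rpow (by positivity) ?_ hβ1.le
        rw [inv_div, div_mul_eq_mul_div, div_le_iff₀ hyn]
        nlinarith
      calc ‖curl U y‖ ≤ κ * M * (‖y‖ / (2 * R)) ^ (-(β + 1)) := by rw [mul_assoc]; exact h1
        _ ≤ κ * M * ((2 * R + 1) ^ (β + 1) * (1 + ‖y‖) ^ (-(β + 1))) :=
            mul_le_mul_of_nonneg_left h2 (by positivity)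
        _ = (κ * M * (2 * R + 1) ^ (β + 1)) * (1 + ‖y‖) ^ (-(β + 1)) := by ring
        _ ≤ A * (1 + ‖y‖) ^ (-(β + 1)) := by
            refine mul_le_mul_of_nonneg_right ?_ hJr
            rw [hA_def]
            exact le_add_of_nonneg_left (by positivity)
  have hgcont : Continuous fun y : EuclideanSpace ℝ (Fin 3) => A * (1 + ‖y‖) ^ (-(β + 1)) :=
    continuous_const.mul ((continuous_const.add continuous_norm).rpow_const
      fun y => Or.inl (by positivity : (1 + ‖y‖) ≠ 0))
  have hg : MemLp (fun y : EuclideanSpace ℝ (Fin 3) => A * (1 + ‖y‖) ^ (-(β + 1)))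
      (ENNReal.ofReal p) volume := by
    have hp0' : ENNReal.ofReal p ≠ 0 := by
      rw [Ne, ENNReal.ofReal_eq_zero, not_le]; exact hp0
    rw [← integrable_norm_rpow_iff hgcont.aestronglyMeasurable hp0' ENNReal.ofReal_ne_top,
      ENNReal.toReal_ofReal hp0.le]
    have h3 : (Module.finrank ℝ (EuclideanSpace ℝ (Fin 3)) : ℝ) < p * (β + 1) := by
      rw [finrank_euclideanSpace_fin]
      push_cast
      have := (div_lt_iff₀ hβ1').1 hpβ
      linarith
    have hint := (integrable_one_add_norm (μ := (volume : Measure (EuclideanSpace ℝ (Fin 3))))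
      h3).const_mul (A ^ p)
    refine hint.congr (ae_of_all _ fun y => ?_)
    have hJ : 0 < 1 + ‖y‖ := by positivity
    simp only
    rw [Real.norm_of_nonneg (mul_nonneg hA0 (Real.rpow_nonneg hJ.le _)),
      Real.mul_rpow hA0 (Real.rpow_nonneg hJ.le _), ← Real.rpow_mul hJ.le]
    congr 2
    ring
  have hΩp : MemLp (curl U) (ENNReal.ofReal p) volume :=
    hg.of_le hcurl_cont.aestronglyMeasurable (ae_of_all _ fun y => by
      rw [Real.norm_of_nonneg (mul_nonneg hA0 (Real.rpow_nonneg (by positivity) _))]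
      exact hdom y)
  exact chaeShvydkoy2013_vorticity_exclusion_holds α p U P hα hp0 hpα h hstrain hΩp

/-- **Chae–Shvydkoy 2013, Theorem 4.2 (ii), conclusion**: with `−1 < α < β` and `β ≠ 0` the profile
is trivial (a non-zero constant is homogeneous of degree `0` only); for `β = 0` a constant
velocity is possible ("Note that only in the case `β = 0` the constant velocity may be different
from zero"). Census reading: with `c_l = 1/(1+α)`, an exact collapse profile with a power-law far
field `|U| ≈ |y|^{−β}` STEEPER than natural (`β > 1/c_l − 1`) does not exist — no integrability
hypothesis on `(U, P)` (compare BS15 Rem. 1.4, which needs the `L^p` class).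
[cite: ChaeShvydkoy2013, §4.1 Thm. 4.2 (ii)] -/
theorem IsSelfSimilarEulerProfile.eq_zero_of_homogeneous_tail_of_gt {α β R : ℝ}
    {U W : EuclideanSpace ℝ (Fin 3) → EuclideanSpace ℝ (Fin 3)} {P : EuclideanSpace ℝ (Fin 3) → ℝ}
    (h : IsSelfSimilarEulerProfile (1 / (α + 1)) 0 U P) (hα : -1 < α) (hβ : α < β) (hβ0 : β ≠ 0)
    (hR : 0 < R)
    (hW : ∀ ⦃c : ℝ⦄, 0 < c → ∀ ⦃x : EuclideanSpace ℝ (Fin 3)⦄, x ≠ 0 → W (c • x) = c ^ (-β) • W x)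
    (hUW : ∀ ⦃y : EuclideanSpace ℝ (Fin 3)⦄, R < ‖y‖ → U y = W y) :
    U = 0 := by
  obtain ⟨b, hb⟩ := h.exists_eq_const_of_homogeneous_tail_of_gt hα hβ hR hW hUW
  obtain ⟨x, hx⟩ : ∃ x : EuclideanSpace ℝ (Fin 3), ‖x‖ = 2 * R :=
    exists_norm_eq (EuclideanSpace ℝ (Fin 3)) (by positivity)
  have hx0 : x ≠ 0 := by
    intro h0; rw [h0, norm_zero] at hx; linarith
  have hxR : R < ‖x‖ := by rw [hx]; linarith
  have h2x : R < ‖(2 : ℝ) • x‖ := by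
    rw [norm_smul, Real.norm_of_nonneg zero_le_two, hx]; linarith
  have e1 : U ((2 : ℝ) • x) = (2 : ℝ) ^ (-β) • U x := by
    rw [hUW h2x, hW two_pos hx0, hUW hxR]
  rw [hb, hb] at e1
  have hb0 : b = 0 := by
    have e2 : (1 - (2 : ℝ) ^ (-β)) • b = 0 := by rw [sub_smul, one_smul, ← e1, sub_self]
    refine (smul_eq_zero.mp e2).resolve_left ?_
    intro h0
    have e3 : (2 : ℝ) ^ (-β) = 1 := by linarith
    have hlog := congrArg Real.log e3
    rw [Real.log_rpow two_pos, Real.log_one, mul_eq_zero] at hlog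
    rcases hlog with h1 | h1
    · exact hβ0 (neg_eq_zero.mp h1)
    · exact absurd h1 (Real.log_pos one_lt_two).ne'
  funext y
  rw [hb, hb0, Pi.zero_apply]

end FasterTail

section CriticalTail

/-- **From a vanishing shell energy to a vanishing profile.** If a `C²` profile with exponent
`γ = 1/(α+1)`, `α > −1`, is homogeneous near infinity (`U = W` on `{‖y‖ > R}`, `W` homogeneous of
degree `−β`) and `∫_{R<|y|<2R} |U|² = 0`, then `U ≡ 0`: `U` vanishes on the shell (continuity),
hence `W` vanishes off the origin (homogeneity), hence `U` has compact support
(`IsSelfSimilarEulerProfile.eq_zero_of_eq_zero_of_le_norm`). Steps 2–4 of the proof of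
`IsSelfSimilarEulerProfile.eq_zero_of_homogeneous_tail_of_lt`, isolated.
[cite: ChaeShvydkoy2013, §4.1 Thm. 4.2 (proof: "unless `V = 0`. If `V = 0`, however, …")] -/
theorem IsSelfSimilarEulerProfile.eq_zero_of_shellEnergy_eq_zero_of_homogeneous_tail {α β R : ℝ}
    {U W : EuclideanSpace ℝ (Fin 3) → EuclideanSpace ℝ (Fin 3)} {P : EuclideanSpace ℝ (Fin 3) → ℝ}
    (h : IsSelfSimilarEulerProfile (1 / (α + 1)) 0 U P) (hα : -1 < α) (hR : 0 < R)
    (hW : ∀ ⦃c : ℝ⦄, 0 < c → ∀ ⦃x : EuclideanSpace ℝ (Fin 3)⦄, x ≠ 0 → W (c • x) = c ^ (-β) • W x)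
    (hUW : ∀ ⦃y : EuclideanSpace ℝ (Fin 3)⦄, R < ‖y‖ → U y = W y)
    (hI : ∫ y in {y : EuclideanSpace ℝ (Fin 3) | R < ‖y‖ ∧ ‖y‖ < 2 * R}, ‖U y‖ ^ 2 = 0) :
    U = 0 := by
  have hcont : Continuous fun y : EuclideanSpace ℝ (Fin 3) => ‖U y‖ ^ 2 :=
    (h.contDiff_velocity.continuous.norm).pow 2
  set S : Set (EuclideanSpace ℝ (Fin 3)) := {y | R < ‖y‖ ∧ ‖y‖ < 2 * R} with hS_def
  -- `U = 0` on the shell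
  have hshell0 : ∀ y ∈ S, U y = 0 := by
    by_contra hne
    push Not at hne
    obtain ⟨z, hzS, hz⟩ := hne
    have hint : IntegrableOn (fun y : EuclideanSpace ℝ (Fin 3) => ‖U y‖ ^ 2) S volume :=
      ((hcont.continuousOn.integrableOn_compact (isCompact_closedBall 0 (2 * R))).mono_set
        ball_subset_closedBall).mono_set fun y hy => by rw [mem_ball_zero_iff]; exact hy.2
    have hpos : 0 < ∫ y in S, ‖U y‖ ^ 2 := by
      rw [setIntegral_pos_iff_support_of_nonneg_ae
        (Eventually.of_forall fun y => by simp only [Pi.zero_apply]; positivity) hint]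
      have hopen : IsOpen ({y : EuclideanSpace ℝ (Fin 3) | ‖U y‖ ^ 2 ≠ 0} ∩ S) :=
        (isOpen_ne_fun hcont continuous_const).inter
          ((isOpen_lt continuous_const continuous_norm).inter
            (isOpen_lt continuous_norm continuous_const))
      exact hopen.measure_pos volume ⟨z, by simpa using hz, hzS⟩
    exact hpos.ne' hI
  -- the tail `W` vanishes off the origin
  have hW0 : ∀ x : EuclideanSpace ℝ (Fin 3), x ≠ 0 → W x = 0 := by
    intro x hx
    have hxn : 0 < ‖x‖ := norm_pos_iff.mpr hx
    set c : ℝ := (3 * R / 2) / ‖x‖ with hc_def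
    have hc : 0 < c := by positivity
    have hcx : ‖c • x‖ = 3 * R / 2 := by
      rw [norm_smul, Real.norm_of_nonneg hc.le, hc_def, div_mul_cancel₀ _ hxn.ne']
    have hmem : c • x ∈ S := by
      rw [hS_def, mem_setOf_eq, hcx]; constructor <;> linarith
    have h1 : U (c • x) = 0 := hshell0 _ hmem
    rw [hUW (by rw [hcx]; linarith), hW hc hx] at h1
    exact (smul_eq_zero.mp h1).resolve_left (Real.rpow_pos_of_pos hc _).ne'
  refine h.eq_zero_of_eq_zero_of_le_norm hα (R := R + 1) fun y hy => ?_
  have hy0 : y ≠ 0 := by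
    intro h0; rw [h0, norm_zero] at hy; linarith
  rw [hUW (by linarith)]
  exact hW0 y hy0

/-- One dyadic step of energy accumulation: `∫_{|y|<2L} f ≥ ∫_{|y|<L} f + ∫_{L<|y|<2L} f` for a
continuous non-negative integrand (the ball and the open shell are disjoint subsets of the
doubled ball). [folklore] -/
private theorem setIntegral_ball_add_shell_le {f : EuclideanSpace ℝ (Fin 3) → ℝ}
    (hf : Continuous f) (hf0 : ∀ y, 0 ≤ f y) (L : ℝ) :
    (∫ y in ball (0 : EuclideanSpace ℝ (Fin 3)) L, f y) +
        ∫ y in {y : EuclideanSpace ℝ (Fin 3) | L < ‖y‖ ∧ ‖y‖ < 2 * L}, f y ≤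
      ∫ y in ball (0 : EuclideanSpace ℝ (Fin 3)) (2 * L), f y := by
  have hint : IntegrableOn f (ball (0 : EuclideanSpace ℝ (Fin 3)) (2 * L)) volume :=
    (hf.continuousOn.integrableOn_compact (isCompact_closedBall 0 _)).mono_set ball_subset_closedBall
  have hdisj : Disjoint (ball (0 : EuclideanSpace ℝ (Fin 3)) L)
      {y : EuclideanSpace ℝ (Fin 3) | L < ‖y‖ ∧ ‖y‖ < 2 * L} := by
    rw [Set.disjoint_left]
    intro y hy hy'
    rw [mem_ball_zero_iff] at hy
    exact lt_asymm hy hy'.1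
  have hsub : ball (0 : EuclideanSpace ℝ (Fin 3)) L ∪
      {y : EuclideanSpace ℝ (Fin 3) | L < ‖y‖ ∧ ‖y‖ < 2 * L} ⊆
        ball (0 : EuclideanSpace ℝ (Fin 3)) (2 * L) := by
    intro y hy
    rw [mem_ball_zero_iff]
    rcases hy with hy | hy
    · rw [mem_ball_zero_iff] at hy
      have : L < 2 * L ∨ 2 * L ≤ L := lt_or_ge L (2 * L)
      rcases this with h2 | h2
      · exact hy.trans h2
      · -- `L ≤ 0`: the ball is empty unless... then `‖y‖ < L ≤ 0` is impossible
        linarith [norm_nonneg y]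
    · exact hy.2
  rw [← setIntegral_union hdisj (measurableSet_twoShell L) (hint.mono_set
      (subset_union_left.trans hsub)) (hint.mono_set (subset_union_right.trans hsub))]
  exact setIntegral_mono_set hint (ae_of_all _ hf0) (ae_of_all _ hsub)

/-- **Chae–Shvydkoy 2013, Theorem 4.2 (iii): the energy-critical case `α = β = 3/2`.** A `C²`
profile with exponent `γ = 2/5` (`α = 3/2`) whose ball energies stay BOUNDED,
`∫_{|y|<L}|U|² ≤ C` for `L ≥ L₀` (Chae–Shvydkoy (1.3)/Cor. 3.4 at `α = N/2`: `v ∈ L²`; automatic for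
an exact collapse of a finite-energy solution), and which is homogeneous near infinity of the
natural degree `−3/2`, is trivial: every dyadic shell `{2^k R < |y| < 2^{k+1} R}` carries the SAME
energy `I` ("`∫_{L≤|y|≤ML}|v|² = log M ∫|V|²`"), so `n I ≤ C` for all `n`, `I = 0`, and
`eq_zero_of_shellEnergy_eq_zero_of_homogeneous_tail` concludes.
[cite: ChaeShvydkoy2013, §4.1 Thm. 4.2 (iii)] -/
theorem IsSelfSimilarEulerProfile.eq_zero_of_homogeneous_tail_three_halves {R C L₀ : ℝ}
    {U W : EuclideanSpace ℝ (Fin 3) → EuclideanSpace ℝ (Fin 3)} {P : EuclideanSpace ℝ (Fin 3) → ℝ}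
    (h : IsSelfSimilarEulerProfile (1 / ((3 / 2 : ℝ) + 1)) 0 U P) (hR : 0 < R)
    (hW : ∀ ⦃c : ℝ⦄, 0 < c → ∀ ⦃x : EuclideanSpace ℝ (Fin 3)⦄, x ≠ 0 →
      W (c • x) = c ^ (-(3 / 2 : ℝ)) • W x)
    (hUW : ∀ ⦃y : EuclideanSpace ℝ (Fin 3)⦄, R < ‖y‖ → U y = W y)
    (hbdd : ∀ L : ℝ, L₀ ≤ L → ∫ y in ball (0 : EuclideanSpace ℝ (Fin 3)) L, ‖U y‖ ^ 2 ≤ C) :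
    U = 0 := by
  have hcont : Continuous fun y : EuclideanSpace ℝ (Fin 3) => ‖U y‖ ^ 2 :=
    (h.contDiff_velocity.continuous.norm).pow 2
  set I : ℝ := ∫ y in {y : EuclideanSpace ℝ (Fin 3) | R < ‖y‖ ∧ ‖y‖ < 2 * R}, ‖U y‖ ^ 2
    with hI_def
  have hI0 : 0 ≤ I := setIntegral_nonneg (measurableSet_twoShell R) fun y _ => by positivity
  -- every dyadic shell carries the energy `I`
  have hshell : ∀ k : ℕ, ∫ y in {y : EuclideanSpace ℝ (Fin 3) |
      2 ^ k * R < ‖y‖ ∧ ‖y‖ < 2 * (2 ^ k * R)}, ‖U y‖ ^ 2 = I := by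
    intro k
    have hs : (1 : ℝ) ≤ 2 ^ k := one_le_pow₀ (by norm_num)
    rw [setIntegral_shell_normSq_of_homogeneous_tail hR hW hUW hs, hI_def]
    norm_num
  -- accumulation: `E(2^n R) ≥ n I`
  have hacc : ∀ n : ℕ, (n : ℝ) * I ≤ ∫ y in ball (0 : EuclideanSpace ℝ (Fin 3)) (2 ^ n * R), ‖U y‖ ^ 2 := by
    intro n
    induction n with
    | zero =>
      simp only [Nat.cast_zero, zero_mul]
      exact setIntegral_nonneg measurableSet_ball fun y _ => by positivity
    | succ n ih =>
      have hstep := setIntegral_ball_add_shell_le hcont (fun y => by positivity) (2 ^ n * R)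
      rw [hshell n] at hstep
      rw [show (2 : ℝ) ^ (n + 1) * R = 2 * (2 ^ n * R) by ring]
      push_cast
      linarith
  -- let `n → ∞`
  by_contra hU
  have hIpos : 0 < I := by
    rcases eq_or_lt_of_le hI0 with h0 | h0
    · exact absurd (h.eq_zero_of_shellEnergy_eq_zero_of_homogeneous_tail (by norm_num) hR hW hUW
        h0.symm) hU
    · exact h0
  -- choose `n` with `2^n R ≥ L₀` and `n I > C`
  obtain ⟨n₁, hn₁⟩ : ∃ n₁ : ℕ, L₀ / R ≤ 2 ^ n₁ := by
    obtain ⟨n, hn⟩ := pow_unbounded_of_one_lt (L₀ / R) (by norm_num : (1 : ℝ) < 2)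
    exact ⟨n, hn.le⟩
  obtain ⟨n₂, hn₂⟩ := exists_nat_gt (C / I)
  set n : ℕ := max n₁ n₂ with hn_def
  have hnR : L₀ ≤ 2 ^ n * R := by
    have h1 : L₀ / R ≤ 2 ^ n :=
      hn₁.trans (pow_le_pow_right₀ (by norm_num) (le_max_left _ _))
    rwa [div_le_iff₀ hR] at h1
  have hnI : C < (n : ℝ) * I := by
    have h1 : C / I < n := hn₂.trans_le (by exact_mod_cast le_max_right n₁ n₂)
    rwa [div_lt_iff₀ hIpos] at h1
  exact lt_irrefl _ ((hnI.trans_le (hacc n)).trans_le (hbdd _ hnR))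

end CriticalTail


section AmbientTail

/-- **Ambient form of Thm 4.2 (ii): an exact locally self-similar collapse cannot have a
homogeneous far field STEEPER than the natural one.** For a classical Euler solution on `[0,T)`,
exactly locally self-similar on `B_{ρ₀}(x₀)` with exponent `γ = 1/(α+1)`, `α > −1`, and a `C²`
profile `v` homogeneous near infinity of degree `−β` with `α < β`, `β ≠ 0`: `v ≡ 0` (the profile
system is supplied by `exists_pressureProfile_of_locallySelfSimilar`; no energy or integrability
hypothesis is used). [cite: ChaeShvydkoy2013, §4.1 Thm. 4.2 (ii); BronziShvydkoy2015, §2 Lemma 2.1] -/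
theorem eq_zero_of_locallySelfSimilar_of_homogeneous_tail_of_gt {T α ρ₀ β R : ℝ}
    {x₀ : EuclideanSpace ℝ (Fin 3)}
    {u : ℝ → EuclideanSpace ℝ (Fin 3) → EuclideanSpace ℝ (Fin 3)}
    {p : ℝ → EuclideanSpace ℝ (Fin 3) → ℝ}
    {v W : EuclideanSpace ℝ (Fin 3) → EuclideanSpace ℝ (Fin 3)}
    (hT : 0 < T) (hα : -1 < α) (hρ₀ : 0 < ρ₀)
    (hsol : IsClassicalEulerSolutionOn (Ico 0 T) 0 u p) (hv : ContDiff ℝ 2 v)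
    (hss : ∀ t ∈ Ico 0 T, ∀ x ∈ ball x₀ ρ₀,
      u t x = selfSimilarCollapse (1 / (α + 1)) T v t (x - x₀))
    (hβ : α < β) (hβ0 : β ≠ 0) (hR : 0 < R)
    (hW : ∀ ⦃c : ℝ⦄, 0 < c → ∀ ⦃x : EuclideanSpace ℝ (Fin 3)⦄, x ≠ 0 → W (c • x) = c ^ (-β) • W x)
    (hvW : ∀ ⦃y : EuclideanSpace ℝ (Fin 3)⦄, R < ‖y‖ → v y = W y) :
    v = 0 := by
  have hγ : 0 < 1 / (α + 1) := by
    have : 0 < α + 1 := by linarith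
    positivity
  obtain ⟨q, hprof, -⟩ := exists_pressureProfile_of_locallySelfSimilar hT hγ hρ₀ hsol hv hss
  exact hprof.eq_zero_of_homogeneous_tail_of_gt hα hβ hβ0 hR hW hvW

/-- **Ambient form of Thm 4.2 (iii): the energy-critical collapse `α = 3/2` (`c_l = 2/5`) with a
homogeneous far field of the natural degree `−3/2` is trivial.** For a classical finite-energy
Euler solution on `[0,T)` in the Beale–Kato–Majda class, exactly locally self-similar on
`B_{ρ₀}(x₀)` with exponent `γ = 2/5`, whose `C²` profile is homogeneous near infinity of degree
`−3/2`: `v ≡ 0` (the ball energies are bounded by `energyGrowth_of_locallySelfSimilar` at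
`3 − 2α = 0`). [cite: ChaeShvydkoy2013, §4.1 Thm. 4.2 (iii); BronziShvydkoy2015, §1 eq. (1.6), Rem. 1.5] -/
theorem eq_zero_of_locallySelfSimilar_of_homogeneous_tail_three_halves {T ρ₀ R : ℝ}
    {x₀ : EuclideanSpace ℝ (Fin 3)}
    {u : ℝ → EuclideanSpace ℝ (Fin 3) → EuclideanSpace ℝ (Fin 3)}
    {p : ℝ → EuclideanSpace ℝ (Fin 3) → ℝ}
    {v W : EuclideanSpace ℝ (Fin 3) → EuclideanSpace ℝ (Fin 3)}
    (hT : 0 < T) (hρ₀ : 0 < ρ₀)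
    (hsol : IsClassicalEulerSolutionOn (Ico 0 T) 0 u p)
    (hreg : ∀ T'' < T, HasBoundedSobolevNormsOn (Icc 0 T'') u) (hv : ContDiff ℝ 2 v)
    (hss : ∀ t ∈ Ico 0 T, ∀ x ∈ ball x₀ ρ₀,
      u t x = selfSimilarCollapse (1 / ((3 / 2 : ℝ) + 1)) T v t (x - x₀))
    (hR : 0 < R)
    (hW : ∀ ⦃c : ℝ⦄, 0 < c → ∀ ⦃x : EuclideanSpace ℝ (Fin 3)⦄, x ≠ 0 →
      W (c • x) = c ^ (-(3 / 2 : ℝ)) • W x)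
    (hvW : ∀ ⦃y : EuclideanSpace ℝ (Fin 3)⦄, R < ‖y‖ → v y = W y) :
    v = 0 := by
  have hα : (-1 : ℝ) < 3 / 2 := by norm_num
  have hγ : (0 : ℝ) < 1 / ((3 / 2 : ℝ) + 1) := by norm_num
  obtain ⟨q, hprof, -⟩ := exists_pressureProfile_of_locallySelfSimilar hT hγ hρ₀ hsol hv hss
  refine hprof.eq_zero_of_homogeneous_tail_three_halves hR hW hvW
    (C := (∫ x, ‖u 0 x‖ ^ 2) * ρ₀ ^ (2 * (3 / 2 : ℝ) - 3))
    (L₀ := ρ₀ * T ^ (-(1 / ((3 / 2 : ℝ) + 1)))) fun L hL => ?_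
  have h1 := energyGrowth_of_locallySelfSimilar hT hα hρ₀ hsol hreg hss hL
  rwa [show (3 : ℝ) - 2 * (3 / 2) = 0 by norm_num, Real.rpow_zero, mul_one] at h1

/-- **Ambient form of the compact-support exclusion: no exact locally self-similar collapse has a
spatially LOCALISED profile.** For a classical Euler solution on `[0,T)`, exactly locally
self-similar on `B_{ρ₀}(x₀)` with exponent `γ = 1/(α+1)`, `α > −1`, whose `C²` profile vanishes
outside some ball `{‖y‖ < R}`: `v ≡ 0` (profile system by
`exists_pressureProfile_of_locallySelfSimilar`, then
`IsSelfSimilarEulerProfile.eq_zero_of_eq_zero_of_le_norm`; no energy or integrability hypothesis).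
Census reading: a "ring-localised" or "core-localised" exact self-similar collapse profile does not exist, for
any `c_l`. [cite: ChaeShvydkoy2013, §4.1 Thm. 4.2 (proof) with §4 Thm. 4.1; BronziShvydkoy2015, §2 Lemma 2.1] -/
theorem eq_zero_of_locallySelfSimilar_of_eq_zero_of_le_norm {T α ρ₀ R : ℝ}
    {x₀ : EuclideanSpace ℝ (Fin 3)}
    {u : ℝ → EuclideanSpace ℝ (Fin 3) → EuclideanSpace ℝ (Fin 3)}
    {p : ℝ → EuclideanSpace ℝ (Fin 3) → ℝ}
    {v : EuclideanSpace ℝ (Fin 3) → EuclideanSpace ℝ (Fin 3)}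
    (hT : 0 < T) (hα : -1 < α) (hρ₀ : 0 < ρ₀)
    (hsol : IsClassicalEulerSolutionOn (Ico 0 T) 0 u p) (hv : ContDiff ℝ 2 v)
    (hss : ∀ t ∈ Ico 0 T, ∀ x ∈ ball x₀ ρ₀,
      u t x = selfSimilarCollapse (1 / (α + 1)) T v t (x - x₀))
    (hzero : ∀ y : EuclideanSpace ℝ (Fin 3), R ≤ ‖y‖ → v y = 0) :
    v = 0 := by
  have hγ : 0 < 1 / (α + 1) := by
    have : 0 < α + 1 := by linarith
    positivity
  obtain ⟨q, hprof, -⟩ := exists_pressureProfile_of_locallySelfSimilar hT hγ hρ₀ hsol hv hss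
  exact hprof.eq_zero_of_eq_zero_of_le_norm hα hzero

end AmbientTail

end Literature.Analysis.FluidPDE

end
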